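import Mathlib.MeasureTheory.Measure.Haar.Unique
import HarnessLib

/-!
# Canonically normalised Haar integrals are transported by isomorphisms of topological groups: `μ_B(K)⁻¹ ∫_B F dμ_B = μ_A(e⁻¹K)⁻¹ ∫_A F ∘ e dμ_A`
(Deitmar–Echterhoff (2014), Thm. 1.5.3 (uniqueness of Haar measure); Rogawski (1990), §4.9 p. 56: the change of variables `T_H ≃ T` in the proof of Lemma 4.9.2)

Topic `NumberTheory/Automorphic`; namespace `Literature.NumberTheory.Automorphic`.  THEOREMS ONLY (generic measure theory; no definition, no `sorry`).  Cell
`pub/hodgecm-mathlib`, line «CMCharIdentityTest» (F0P3b) — the (T3) corollary of ★ `Rogawski1990.EndoscopicLeviTorusTransport` for the S4 closer of Lemma 4.9.2 (B-p18 (g32)):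
with `e : T_H ≃ₜ* T₃` (★ `exists_leviTorus_continuousMulEquiv`) and `e⁻¹(T₃ ∩ K₃) = T_H ∩ K_H` (★ `endoEmbLocal_mem_cmLocalIntegralLevel_iff`), ANY Haar measures `μ_{T_H}`,
`μ_T` give `μ_T(T₃ ∩ K₃)⁻¹ ∫_{T₃} Φ dμ_T = μ_{T_H}(T_H ∩ K_H)⁻¹ ∫_{T_H} Φ ∘ e dμ_{T_H}` — NO constant.

* `inv_measure_smul_integral_map_continuousMulEquiv` — the transported measure: `(e_*μ_A)(K)⁻¹ • ∫ F d(e_*μ_A) = μ_A(e⁻¹K)⁻¹ • ∫ F ∘ e dμ_A` (any set `K`).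
* **`inv_measure_smul_integral_eq_of_continuousMulEquiv`** — any two Haar measures: `μ_B(K)⁻¹ • ∫ F dμ_B = μ_A(e⁻¹K)⁻¹ • ∫ F ∘ e dμ_A` (`B` second countable locally compact;
  uniqueness of Haar measure `μ_B = c • e_*μ_A`, the scalar cancels against the normalisation).
* (EDITION 2) `ae_comp_continuousMulEquiv_of_ae` ∕ `ae_of_ae_comp_continuousMulEquiv` — `μ_B`-a.e. `P` ⇔ `μ_A`-a.e. `P ∘ e` for any two Haar measures (same null sets).
-/

set_option autoImplicit false

noncomputable section

open MeasureTheory Measure Set Topology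
open scoped NNReal ENNReal

namespace Literature.NumberTheory.Automorphic

variable {A B E : Type*} [Group A] [TopologicalSpace A] [MeasurableSpace A] [BorelSpace A]
  [Group B] [TopologicalSpace B] [MeasurableSpace B] [BorelSpace B] [NormedAddCommGroup E] [NormedSpace ℝ E]

/-- The underlying function of the measurable equivalence of `e : A ≃ₜ* B` is `e`. [cite: DeitmarEchterhoff2014, Thm. 1.5.3] -/
private theorem coe_toMeasurableEquiv_toHomeomorph (e : A ≃ₜ* B) : (⇑((e : A ≃ₜ B).toMeasurableEquiv) : A → B) = ⇑e := by
  rw [Homeomorph.toMeasurableEquiv_coe]; rfl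

/-- **Normalised integrals under the transported measure**: `(e_*μ)(K)⁻¹ • ∫ F d(e_*μ) = μ(e⁻¹K)⁻¹ • ∫ F ∘ e dμ` for an isomorphism of topological groups `e : A ≃ₜ* B`,
any measure `μ` on `A` and ANY set `K ⊆ B` (`e` is a measurable equivalence: `(e_*μ)(K) = μ(e⁻¹K)` without measurability of `K`). [cite: DeitmarEchterhoff2014, Thm. 1.5.3] -/
theorem inv_measure_smul_integral_map_continuousMulEquiv (e : A ≃ₜ* B) (μ : Measure A) (K : Set B) (F : B → E) :
    ((Measure.map (⇑e) μ) K).toReal⁻¹ • ∫ y, F y ∂(Measure.map (⇑e) μ) = (μ (⇑e ⁻¹' K)).toReal⁻¹ • ∫ x, F (e x) ∂μ := by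
  rw [← coe_toMeasurableEquiv_toHomeomorph e, MeasurableEquiv.map_apply, integral_map_equiv]

/-- **CANONICALLY NORMALISED HAAR INTEGRALS ARE TRANSPORTED BY ISOMORPHISMS OF TOPOLOGICAL GROUPS.**  For `e : A ≃ₜ* B` (`B` second countable, locally compact),
Haar measures `μ_A` on `A` and `μ_B` on `B`, any set `K ⊆ B` and any integrand `F`:
`μ_B(K)⁻¹ • ∫_B F dμ_B = μ_A(e⁻¹ K)⁻¹ • ∫_A F ∘ e dμ_A`.
Uniqueness of Haar measure gives `μ_B = c • e_*μ_A` with `0 < c < ∞` (Mathlib `isMulLeftInvariant_eq_smul`, `haarScalarFactor`); the scalar cancels against the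
normalisation (and both sides vanish when `μ_A(e⁻¹K) ∈ {0, ∞}`).  This is the change of variables between the van Dijk torus formulas on `H_v` and on `G_v` in the
proof of Rogawski's Lemma 4.9.2, where `K = T ∩ K_v` and `e⁻¹K = T_H ∩ K_{H,v}`. [cite: DeitmarEchterhoff2014, Thm. 1.5.3] [cite: Rogawski1990, §4.9 Lemma 4.9.2 p. 56] -/
theorem inv_measure_smul_integral_eq_of_continuousMulEquiv [IsTopologicalGroup A] [IsTopologicalGroup B] [LocallyCompactSpace B]
    [SecondCountableTopology B] (e : A ≃ₜ* B) (μA : Measure A) (μB : Measure B) [μA.IsHaarMeasure] [μB.IsHaarMeasure] (K : Set B) (F : B → E) :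
    (μB K).toReal⁻¹ • ∫ y, F y ∂μB = (μA (⇑e ⁻¹' K)).toReal⁻¹ • ∫ x, F (e x) ∂μA := by
  rw [← inv_measure_smul_integral_map_continuousMulEquiv e μA K F]
  -- `μ_B = c • e_*μ_A`, `0 < c`
  have hμB : μB = haarScalarFactor μB (Measure.map (⇑e) μA) • Measure.map (⇑e) μA := isMulLeftInvariant_eq_smul μB _
  have hc : ((haarScalarFactor μB (Measure.map (⇑e) μA) : ℝ≥0) : ℝ) ≠ 0 :=
    NNReal.coe_ne_zero.2 (haarScalarFactor_pos_of_isHaarMeasure μB _).ne'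
  rw [hμB, Measure.coe_nnreal_smul_apply, integral_smul_nnreal_measure, ENNReal.toReal_mul, ENNReal.coe_toReal, NNReal.smul_def, smul_smul, mul_inv,
    mul_right_comm, inv_mul_cancel₀ hc, one_mul]

/-! ## (EDITION 2) Almost-everywhere statements are transported too -/

/-- **A.e. under an isomorphism of topological groups, ANY two Haar measures**: for `e : A ≃ₜ* B` (`B` second countable, locally compact) and Haar measures `μ_A`, `μ_B`, a
property holding `μ_B`-a.e. on `B` holds `μ_A`-a.e. after composing with `e` (`e_*μ_A` is a Haar measure, hence a POSITIVE multiple of `μ_B` by uniqueness, so it has the same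
null sets; `e` is a measurable equivalence, so `(e_*μ_A)`-a.e. is `μ_A`-a.e. after composition, no measurability of the property needed).  In Lemma 4.9.2: the `G`-regular
locus, of full measure in `T` (★ `CMTorusRegularAEPairwise`), pulls back to a full-measure subset of `T_H`. [cite: DeitmarEchterhoff2014, Thm. 1.5.3] [cite: Rogawski1990, §4.9 Lemma 4.9.2 p. 56] -/
theorem ae_comp_continuousMulEquiv_of_ae [IsTopologicalGroup A] [IsTopologicalGroup B] [LocallyCompactSpace B] [SecondCountableTopology B]
    (e : A ≃ₜ* B) (μA : Measure A) (μB : Measure B) [μA.IsHaarMeasure] [μB.IsHaarMeasure] {P : B → Prop} (h : ∀ᵐ y ∂μB, P y) :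
    ∀ᵐ x ∂μA, P (e x) := by
  have hμB : μB = haarScalarFactor μB (Measure.map (⇑e) μA) • Measure.map (⇑e) μA := isMulLeftInvariant_eq_smul μB _
  have hc : haarScalarFactor μB (Measure.map (⇑e) μA) ≠ 0 := (haarScalarFactor_pos_of_isHaarMeasure μB _).ne'
  rw [hμB, ae_smul_measure_iff hc, ← coe_toMeasurableEquiv_toHomeomorph e, ((e : A ≃ₜ B).toMeasurableEquiv.measurableEmbedding).ae_map_iff] at h
  rw [← coe_toMeasurableEquiv_toHomeomorph e]
  exact h

/-- The converse direction: a property holding `μ_A`-a.e. after composing with `e` holds `μ_B`-a.e. (apply the previous lemma to `e.symm`). [cite: DeitmarEchterhoff2014, Thm. 1.5.3] -/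
theorem ae_of_ae_comp_continuousMulEquiv [IsTopologicalGroup A] [IsTopologicalGroup B] [LocallyCompactSpace A] [SecondCountableTopology A]
    (e : A ≃ₜ* B) (μA : Measure A) (μB : Measure B) [μA.IsHaarMeasure] [μB.IsHaarMeasure] {P : B → Prop} (h : ∀ᵐ x ∂μA, P (e x)) :
    ∀ᵐ y ∂μB, P y := by
  have h' := ae_comp_continuousMulEquiv_of_ae e.symm μB μA (P := fun x => P (e x)) h
  simpa only [ContinuousMulEquiv.apply_symm_apply] using h'

end Literature.NumberTheory.Automorphic

end
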